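import Summits.QuantumFields.YangMills.Theorems.GronwallGapAnalyticDetourStubTorusPartitionDictionary
import Summits.QuantumFields.YangMills.Theorems.GronwallGapAnalyticDetourStubTorusPressureLimit
import Summits.QuantumFields.YangMills.Theorems.GronwallGapAnalyticDetourStubFiniteVolumeKPLog
import Literature.Analysis.Complex.VitaliConvergence

/-!
# Crux `AnalyticDetour` (stmt-QuantumFields-8801), line `registered`:
# the stub `stub_nearHaarAnalytic` (Gateaux-analytic torus pressure near the Haar point)

Registered stub of the skeleton `Cruxes/AnalyticDetour/Lines/registered.lean` (route
`GronwallGap`, sub-problem `YangMills`), proved verbatim.  For a compact second-countable group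
`G` with a Borel σ-algebra there is `η > 0` such that every continuous positive single-plaquette
weight `v` with `|log v| ≤ η` pointwise has, in every continuous class direction `φ`, a torus
pressure `p(t) = lim_L (L+1)⁻⁴ log Z_{L+1}(v · e^{tφ})` defined for all real `t` and real-analytic
at `t = 0` (the `AnP` clause of the crux, in the crux's `withDensity … univ` spelling of the torus
partition function `Z`).

Proof (the glue of three landed stubs of the line and Vitali's convergence theorem):

* real-axis limits for every `t` — `stub_torusPressureLimit` (thermodynamic limit of the torus
  pressure of the continuous positive weight `v · e^{tφ}`), transported to the crux's spelling by
  the dictionary `stub_torusPartitionDictionary`;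
* analyticity at `0` — with `η` half the constant of `stub_finiteVolumeKPLog` and
  `t₀ := (η/2)/(C+1)`, `|φ| ≤ C`, the pair `a := log v`, `b := t₀ φ` has `|a| + |b| ≤ η`, so the
  finite-volume pressures `s ↦ (L+1)⁻⁴ log Z_{L+1}(e^{a + s b}) = (L+1)⁻⁴ log Z_{L+1}(v e^{(t₀ s)φ})`
  extend to holomorphic functions `F_L` on the unit disc bounded uniformly in `L`; they converge at
  every real point of the disc, hence (Vitali,
  `Literature.Analysis.Complex.exists_tendstoLocallyUniformlyOn_of_frequently_tendsto`) locally
  uniformly to a holomorphic `f` with `f(s) = p(t₀ s)` for real `|s| < 1`; thus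
  `p(t) = Re f(t/t₀)` near `0` is real-analytic (restriction of scalars and composition with the
  real-linear maps `t ↦ (t/t₀ : ℂ)` and `Re`).

The analytic heart is isolated in `analyticAt_of_pressure_family`, stated for an abstract
pressure functional `Pz : (G → ℝ) → ℕ → ℝ`, so that no measure theory enters the Vitali argument.
The Hausdorff hypothesis and the class-function property of `φ` in the registered signature are
not used.  No named facts are used; no definitions are introduced.
-/

namespace Summit.QuantumFields.YangMills.Theorems

open MeasureTheory Filter Metric
open scoped Topology
open Literature.MathematicalPhysics.QuantumFieldTheory (haarProbability GaugeConfig Plaquette Edge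
  plaquetteHolonomy)
open Literature.MathematicalPhysics.QuantumLattice (groupHeatKernelWeight)

/-- A property holding at every non-zero real point of `(-1, 1) ⊆ ℂ` holds frequently on the
punctured neighbourhoods of `0` in `ℂ` (the real axis accumulates at `0`). -/
private theorem frequently_nhdsNE_zero_of_real {P : ℂ → Prop}
    (h : ∀ s : ℝ, s ≠ 0 → |s| < 1 → P (s : ℂ)) : ∃ᶠ z in 𝓝[≠] (0 : ℂ), P z := by
  have hmap : Tendsto (fun s : ℝ => (s : ℂ)) (𝓝[≠] (0 : ℝ)) (𝓝[≠] (0 : ℂ)) := by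
    refine tendsto_nhdsWithin_iff.2 ⟨?_, ?_⟩
    · have h0 : Tendsto (fun s : ℝ => (s : ℂ)) (𝓝 (0 : ℝ)) (𝓝 (0 : ℂ)) := by
        simpa using Complex.continuous_ofReal.tendsto (0 : ℝ)
      exact h0.mono_left nhdsWithin_le_nhds
    · filter_upwards [self_mem_nhdsWithin] with s hs
      exact Set.mem_compl_singleton_iff.2
        (Complex.ofReal_ne_zero.2 (Set.mem_compl_singleton_iff.1 hs))
  have hev : ∀ᶠ s : ℝ in 𝓝[≠] (0 : ℝ), P (s : ℂ) := by
    rw [eventually_nhdsWithin_iff]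
    filter_upwards [Metric.ball_mem_nhds (0 : ℝ) one_pos] with s hs hs0
    rw [mem_ball_zero_iff, Real.norm_eq_abs] at hs
    exact h s (Set.mem_compl_singleton_iff.1 hs0) hs
  exact hmap.frequently hev.frequently

/-- Real-analyticity from a holomorphic extension after rescaling: if `p : ℝ → ℝ` agrees on
`|t| < t₀` with `t ↦ f (t / t₀)` for some `f` holomorphic on the unit disc, then `p` is
real-analytic at `0`. -/
private theorem analyticAt_of_ofReal_eq_rescaled {f : ℂ → ℂ} (hf : DifferentiableOn ℂ f (ball 0 1))
    {t₀ : ℝ} (ht₀ : 0 < t₀) {p : ℝ → ℝ}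
    (hp : ∀ t : ℝ, |t| < t₀ → (p t : ℂ) = f ((t₀⁻¹ * t : ℝ) : ℂ)) : AnalyticAt ℝ p 0 := by
  have hf0 : AnalyticAt ℂ f 0 :=
    hf.analyticAt (Metric.isOpen_ball.mem_nhds (Metric.mem_ball_self one_pos))
  have hg : AnalyticAt ℝ (fun t : ℝ => ((t₀⁻¹ * t : ℝ) : ℂ)) 0 :=
    (Complex.ofRealCLM.analyticAt _).comp (analyticAt_const.mul analyticAt_id)
  have hcomp : AnalyticAt ℝ (f ∘ fun t : ℝ => ((t₀⁻¹ * t : ℝ) : ℂ)) 0 :=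
    (hf0.restrictScalars (𝕜 := ℝ)).comp_of_eq hg (by simp)
  have hre : AnalyticAt ℝ (fun t : ℝ => (f ((t₀⁻¹ * t : ℝ) : ℂ)).re) 0 :=
    (Complex.reCLM.analyticAt _).comp hcomp
  refine hre.congr ?_
  filter_upwards [Metric.ball_mem_nhds (0 : ℝ) ht₀] with t ht
  rw [mem_ball_zero_iff, Real.norm_eq_abs] at ht
  have h := congrArg Complex.re (hp t ht)
  rw [Complex.ofReal_re] at h
  exact h.symm

/-- **The analytic heart, for an abstract pressure functional.**  Let `Pz v L` be "the volume-`L`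
pressure of the weight `v`" on a compact space `G`.  Assume (A) `Pz v` converges as `L → ∞` for
every continuous positive `v`, and (C) for continuous `a b` with `|a| + |b| ≤ η` the real-axis
functions `t ↦ Pz (e^{a + t b}) L` extend to holomorphic functions on the unit disc bounded
uniformly in `L`.  Then for `v` continuous positive with `|log v| ≤ η/2` and `φ` continuous, the
limits `p t := lim_L Pz (v e^{tφ}) L` form a function real-analytic at `0` (rescale `b := t₀ φ`,
Vitali's theorem on the unit disc, restriction of the holomorphic limit to the real axis). -/
private theorem analyticAt_of_pressure_family {G : Type} [TopologicalSpace G] [CompactSpace G]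
    (Pz : (G → ℝ) → ℕ → ℝ) {η : ℝ} (hη : 0 < η) {B : ℝ}
    (hA : ∀ v : G → ℝ, Continuous v → (∀ g : G, 0 < v g) →
      ∃ P : ℝ, Tendsto (Pz v) atTop (𝓝 P))
    (hC : ∀ a b : G → ℝ, Continuous a → Continuous b → (∀ g : G, |a g| + |b g| ≤ η) →
      ∀ L : ℕ, ∃ F : ℂ → ℂ, DifferentiableOn ℂ F (ball 0 1) ∧
        (∀ z ∈ ball (0 : ℂ) 1, ‖F z‖ ≤ B) ∧
        ∀ t : ℝ, |t| < 1 → F (t : ℂ) = ((Pz (fun g => Real.exp (a g + t * b g)) L : ℝ) : ℂ))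
    {v : G → ℝ} (hv : Continuous v) (hpos : ∀ g : G, 0 < v g)
    (hlog : ∀ g : G, |Real.log (v g)| ≤ η / 2) {φ : G → ℝ} (hφ : Continuous φ) :
    ∃ p : ℝ → ℝ, (∀ t : ℝ, Tendsto (Pz (fun g => v g * Real.exp (t * φ g))) atTop (𝓝 (p t))) ∧
      AnalyticAt ℝ p 0 := by
  classical
  -- Step 1: the real-axis limits, for every real `t`
  have hwc : ∀ t : ℝ, Continuous fun g : G => v g * Real.exp (t * φ g) := fun t =>
    hv.mul (Real.continuous_exp.comp (continuous_const.mul hφ))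
  have hwp : ∀ (t : ℝ) (g : G), 0 < v g * Real.exp (t * φ g) := fun t g =>
    mul_pos (hpos g) (Real.exp_pos _)
  choose p hp using fun t : ℝ => hA _ (hwc t) (hwp t)
  refine ⟨p, hp, ?_⟩
  -- Step 2: a bound on the direction and the rescaling `t₀`
  obtain ⟨C, hCb⟩ : ∃ C : ℝ, ∀ g : G, ‖φ g‖ ≤ C :=
    (HasCompactSupport.of_compactSpace φ).exists_bound_of_continuous hφ
  have hC0 : 0 < |C| + 1 := by positivity
  set t₀ : ℝ := (η / 2) / (|C| + 1) with ht₀_def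
  have ht₀ : 0 < t₀ := div_pos (half_pos hη) hC0
  have hab : ∀ g : G, |Real.log (v g)| + |t₀ * φ g| ≤ η := by
    intro g
    have h1 := hlog g
    have h2 : |t₀ * φ g| ≤ η / 2 := by
      rw [abs_mul, abs_of_pos ht₀]
      have h3 : |φ g| ≤ |C| + 1 :=
        ((Real.norm_eq_abs _).symm.le.trans (hCb g)).trans
          ((le_abs_self C).trans (le_add_of_nonneg_right zero_le_one))
      calc t₀ * |φ g| ≤ t₀ * (|C| + 1) := mul_le_mul_of_nonneg_left h3 ht₀.le
        _ = η / 2 := by rw [ht₀_def, div_mul_cancel₀ _ hC0.ne']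
    linarith
  -- Step 3: the holomorphic bounded extensions of the finite-volume pressures
  choose F hFd hFb hFt using hC (fun g : G => Real.log (v g)) (fun g : G => t₀ * φ g)
    (hv.log fun g => (hpos g).ne') (continuous_const.mul hφ) hab
  -- Step 4: on the real axis `F L s` is the pressure of the weight `v e^{(t₀ s) φ}`
  have hw : ∀ (s : ℝ) (g : G),
      Real.exp (Real.log (v g) + s * (t₀ * φ g)) = v g * Real.exp (t₀ * s * φ g) := by
    intro s g
    rw [Real.exp_add, Real.exp_log (hpos g), ← mul_assoc, mul_comm s t₀]
  have hFs : ∀ s : ℝ, |s| < 1 → ∀ L : ℕ,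
      F L (s : ℂ) = ((Pz (fun g => v g * Real.exp (t₀ * s * φ g)) L : ℝ) : ℂ) := by
    intro s hs L
    rw [hFt L s hs]
    simp only [hw]
  have htend : ∀ s : ℝ, |s| < 1 →
      Tendsto (fun L : ℕ => F L (s : ℂ)) atTop (𝓝 ((p (t₀ * s) : ℝ) : ℂ)) := by
    intro s hs
    have h := (Complex.continuous_ofReal.tendsto _).comp (hp (t₀ * s))
    refine h.congr fun L => ?_
    rw [Function.comp_apply, hFs s hs L]
  -- Step 5: Vitali's theorem on the unit disc
  have hS : ∃ᶠ z in 𝓝[≠] (0 : ℂ), ∃ c : ℂ, Tendsto (fun n => F n z) atTop (𝓝 c) :=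
    frequently_nhdsNE_zero_of_real fun s _ hs => ⟨_, htend s hs⟩
  obtain ⟨f, hf, hlim⟩ :=
    Literature.Analysis.Complex.exists_tendstoLocallyUniformlyOn_of_frequently_tendsto
      Metric.isOpen_ball (convex_ball (0 : ℂ) 1).isPreconnected hFd
      (fun _ _ => ⟨B, 1, one_pos, fun n z hz => hFb n z hz.2⟩) (Metric.mem_ball_self one_pos) hS
  have hfs : ∀ s : ℝ, |s| < 1 → f (s : ℂ) = ((p (t₀ * s) : ℝ) : ℂ) := by
    intro s hs
    have hmem : (s : ℂ) ∈ ball (0 : ℂ) 1 := by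
      rw [mem_ball_zero_iff, Complex.norm_real, Real.norm_eq_abs]
      exact hs
    exact tendsto_nhds_unique (hlim.tendsto_at hmem) (htend s hs)
  -- Step 6: restrict the holomorphic limit to the real axis
  refine analyticAt_of_ofReal_eq_rescaled hf ht₀ fun t ht => ?_
  have hs : |t₀⁻¹ * t| < 1 := by
    rw [abs_mul, abs_of_pos (inv_pos.2 ht₀), inv_mul_lt_iff₀ ht₀, mul_one]
    exact ht
  rw [hfs _ hs, mul_inv_cancel_left₀ ht₀.ne']

/-- **Stub `stub_nearHaarAnalytic` — Gateaux-analytic torus pressure near the Haar point.**  For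
a compact metrisable group `G` (Borel σ-algebra) there is `η > 0` such that every continuous
positive weight `v` with `|log v| ≤ η` has, in every continuous class direction `φ`, a torus
pressure `t ↦ lim_L (L+1)⁻⁴ log Z_{L+1}(v e^{tφ})` defined for all real `t` and real-analytic at
`t = 0`: real-axis limits from `stub_torusPressureLimit` through the dictionary
`stub_torusPartitionDictionary`; analyticity by Vitali's theorem on the unit disc
(`Literature.Analysis.Complex.exists_tendstoLocallyUniformlyOn_of_frequently_tendsto`) applied to
the holomorphic bounded extensions of `stub_finiteVolumeKPLog` after rescaling the direction
(`η` is half the constant of `stub_finiteVolumeKPLog`). -/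
theorem stub_nearHaarAnalytic :
    ∀ (G : Type) [Group G] [TopologicalSpace G] [IsTopologicalGroup G] [CompactSpace G] [T2Space G] [SecondCountableTopology G] [MeasurableSpace G] [BorelSpace G], ∃ η : ℝ, 0 < η ∧ ∀ v : G → ℝ, Continuous v → (∀ g : G, 0 < v g) → (∀ g : G, |Real.log (v g)| ≤ η) → ∀ φ : G → ℝ, Continuous φ → (∀ g h : G, φ (h * g * h⁻¹) = φ g) → ∃ p : ℝ → ℝ, (∀ t : ℝ, Filter.Tendsto (fun L : ℕ => (((L + 1 : ℕ) : ℝ) ^ 4)⁻¹ * Real.log (((MeasureTheory.Measure.pi fun _ : Literature.MathematicalPhysics.QuantumFieldTheory.Edge 4 (L + 1) => Literature.MathematicalPhysics.QuantumFieldTheory.haarProbability G).withDensity (fun U : Literature.MathematicalPhysics.QuantumFieldTheory.GaugeConfig 4 (L + 1) G => ENNReal.ofReal (Literature.MathematicalPhysics.QuantumLattice.groupHeatKernelWeight (fun _ : ℝ => fun g => v g * Real.exp (t * φ g)) 0 U))) Set.univ).toReal) Filter.atTop (nhds (p t))) ∧ AnalyticAt ℝ p 0 := by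
  intro G _ _ _ _ _ _ _ _
  obtain ⟨η, hη, B, hC⟩ := stub_finiteVolumeKPLog G
  refine ⟨η / 2, half_pos hη, fun v hv hpos hlog φ hφ _ => ?_⟩
  obtain ⟨p, hp, hpa⟩ := analyticAt_of_pressure_family
    (fun (w : G → ℝ) (L : ℕ) => (((L + 1 : ℕ) : ℝ) ^ 4)⁻¹ * Real.log
      (∫ U : GaugeConfig 4 (L + 1) G, ∏ q : Plaquette 4 (L + 1),
        w (plaquetteHolonomy U q.1 q.2.1.1 q.2.1.2)
        ∂(Measure.pi fun _ : Edge 4 (L + 1) => haarProbability G)))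
    hη (stub_torusPressureLimit G) hC hv hpos hlog hφ
  refine ⟨p, fun t => (hp t).congr fun L => ?_, hpa⟩
  rw [(stub_torusPartitionDictionary G L (fun g : G => v g * Real.exp (t * φ g))
    (hv.mul (Real.continuous_exp.comp (continuous_const.mul hφ)))
    (fun g => mul_pos (hpos g) (Real.exp_pos _))).2]

end Summit.QuantumFields.YangMills.Theorems
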